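import Literature.MathematicalPhysics.QuantumFieldTheory.Balaban1983to89.B3OddVectorLoopsVanish
import Literature.MathematicalPhysics.QuantumFieldTheory.Balaban1983to89.B3Sect3DegreeCensus

/-!
# `Balaban1983to89.B3OneVectorLegGraphs` — T. Bałaban, *(Higgs)₂,₃ quantum fields in a finite volume. III. Renormalization*,
Commun. Math. Phys. **88** (1983) 411–445 [Balaban1983Higgs3]: p. 431, *"There are graphs with one external vector field leg.
These graphs … do not introduce any new divergences"* — WITNESSES on the concrete model `B3Cor23Concrete` and the p. 434
mechanism instantiated on them

statement-level skeleton of published theorems with citation tags; proofs where landed; nothing here is a claim about the Yang–Mills mass gap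

PDF held: `paper:balaban1983-higgs-2-3-quantum-fields-finite-volume` (journal page = PDF page + 410); text layer p0021/p0024 read,
render `…/b2b-balaban-ref1/pages/1983-cmp88-higgs23-III/1983-cmp88-higgs23-III-p021-x2.png` (p. 431).
CITATION HEADER (lean-in-tree rule).  lit-balaban TYPED SKELETON (HOME `run/shared/lean/pub/lit-balaban/`), reader/typer seat
r15 (gen 15), unit `lit-balaban-r15`, fold owner of SKELETON row **B3.Txt@431** (pp. 431–432, the "remaining classes" paragraph),
second and third sentences, p. 431 [PDF 21], verbatim: *"There are graphs with one external vector field leg. These graphs, the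
graphs with three external vector field legs mentioned previously, and also the graphs with two external scalar field legs, but
at least one differentiated, do not introduce any new divergences"*; the mechanism print gives for the vector-leg graphs is
p. 434 [PDF 24]: *"every graph of this type has at least one loop of scalar field lines with an odd number of vector field legs,
thus with an odd power of q, and we have tr q^{2n+1} = 0"* — PROVED on the model by seat p18 (`B3OddVectorLoops.exists_odd_loop`,
`B3OddVectorLoopsVanish.indexWeight_eq_zero_of_one_or_three`).

WHAT THIS MODULE ADDS (sorry-free, theorems + three concrete graphs; no `Prop` fact).  The EXISTENCE half of the sentence, which
had no named object: graphs of the model with exactly one external vector field leg and no other external leg EXIST, in both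
readings of «vector field leg» used by the cell (gen-2 convention: uncontracted A′-legs and Ã-legs counted together) —
`tadpole18T` (one vertex (1.8)_{0,1}, its two φ′-legs joined through the differentiation, the Ã-leg external: a graph of the
expansion proper, where *"All the A′-legs are contracted"* p. 414), `tadpole18A` (one vertex (1.8)_{1,0}, φ′-legs joined, the
A′-leg uncontracted: the §3 situation after lines are *"replaced by pairs of external legs"* p. 432), and p18's `pair1718`
(`B3Cor23ConcreteProof`, p243434: (1.7) doubly φ′-linked to (1.8)_{1,0}, A′-leg external, D = 0 in d = 3 — a graph of NONPOSITIVE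
degree with one external vector leg, so the sentence is not void); their leg counts (`*_legs`), `exists_graph_oneExtVectorLeg`;
their d = 3 degrees by the budget formula (`tadpole18T_deg`, `tadpole18A_deg`: D = −2); and the CONCLUSION *"do not introduce any
new divergences"* in the form the model proves it — the internal-index weight VANISHES for every N ≥ 1 and every antisymmetric q
(`indexWeight_tadpole18T/18A/pair1718_eq_zero`, hypothesis-free instances of p18's theorem).  NOT here: the other sentences of the
row (p18 `B3ScalarLegParity`, `B3Sect3ScalarSEDegrees`; §3 rows B3.Eq3.21-3.24), class formation G ↦ G_ren (conventions).
-/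

namespace Literature.MathematicalPhysics.QuantumFieldTheory.Balaban1983to89.B3OneVectorLegGraphs

open Finset B3Prop1 B3Sect2Statements B3VertexBridge B3Cor23Concrete B3Cor23ConcreteProof B3DivergentGraphs B3ScalarLegParity
  B3OddVectorLoops B3OddVectorLoopsVanish B3Sect3DegreeCensus

/-! ## Two one-vertex witnesses -/

/-- The (1.8)_{0,1}-tadpole: one vertex (1.8) with n = 0 legs of A′ and n′ = 1 leg of Ã (p. 413), its two φ′-legs joined by one
scalar line (through the differentiated leg), the Ã-leg external — a graph of the expansion with exactly one external vector field
leg and no other external leg (p. 431 *"There are graphs with one external vector field leg"*; cf. the φ′-tadpole of (2.21a)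
p. 430). [cite: Balaban1983Higgs3, p.431] -/
def tadpole18T (nbar : ℕ) (hn : 1 ≤ nbar) : Graph nbar where
  nV := 1
  kind _ := .v18 0 1
  adm _ := by simp [VertexKind.Admissible, hn]
  other x := match x with
    | ⟨i, .inl j⟩ => some ⟨i, .inl j.rev⟩
    | ⟨_, .inr j⟩ => j.elim0
  other_ne := by decide
  other_symm := by decide
  other_isLeft := by decide
  exists_line := by decide

/-- The (1.8)_{1,0}-tadpole: one vertex (1.8) with n = 1 leg of A′ and n′ = 0, its two φ′-legs joined by one scalar line, the
A′-leg NOT contracted — one external vector field leg in the §3 sense (p. 432: lines *"replaced by pairs of external legs"*), no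
other external leg. [cite: Balaban1983Higgs3, p.431] -/
def tadpole18A (nbar : ℕ) (hn : 1 ≤ nbar) : Graph nbar where
  nV := 1
  kind _ := .v18 1 0
  adm _ := by simp [VertexKind.Admissible, hn]
  other x := match x with
    | ⟨i, .inl j⟩ => some ⟨i, .inl j.rev⟩
    | ⟨_, .inr _⟩ => none
  other_ne := by decide
  other_symm := by decide
  other_isLeft := by decide
  exists_line := by decide

variable {nbar : ℕ}

/-- kernel: `tadpole18T` has no external φ′-leg, no uncontracted A′-leg, exactly one Ã-leg, no differentiation on an external
leg, and no vertex (1.13)–(1.15). [cite: Balaban1983Higgs3, p.431] -/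
theorem tadpole18T_legs (hn : 1 ≤ nbar) :
    numExtScalarLegs (tadpole18T nbar hn) = 0 ∧ numExtVectorLegs (tadpole18T nbar hn) = 0 ∧
      numTildeLegs (tadpole18T nbar hn) = 1 ∧ numExtDiffs (tadpole18T nbar hn) = 0 ∧ ¬ (tadpole18T nbar hn).HasVertex1315 := by
  refine ⟨by rfl, by rfl, by rfl, by rfl, ?_⟩
  rintro ⟨i, hi⟩
  simp [tadpole18T, VertexKind.isOfForm1315] at hi

/-- kernel: `tadpole18A` has no external φ′-leg, exactly one uncontracted A′-leg, no Ã-leg, no differentiation on an external leg,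
and no vertex (1.13)–(1.15). [cite: Balaban1983Higgs3, p.431] -/
theorem tadpole18A_legs (hn : 1 ≤ nbar) :
    numExtScalarLegs (tadpole18A nbar hn) = 0 ∧ numExtVectorLegs (tadpole18A nbar hn) = 1 ∧
      numTildeLegs (tadpole18A nbar hn) = 0 ∧ numExtDiffs (tadpole18A nbar hn) = 0 ∧ ¬ (tadpole18A nbar hn).HasVertex1315 := by
  refine ⟨by rfl, by rfl, by rfl, by rfl, ?_⟩
  rintro ⟨i, hi⟩
  simp [tadpole18A, VertexKind.isOfForm1315] at hi

/-- kernel: p18's `pair1718` ((1.7) doubly φ′-linked to (1.8)_{1,0}; `B3Cor23ConcreteProof`, *"a graph with one external vector leg,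
cf. p. 431"*) has no external φ′-leg, exactly one uncontracted A′-leg, no Ã-leg, and no vertex (1.13)–(1.15).
[cite: Balaban1983Higgs3, p.431] -/
theorem pair1718_legs (hn : 1 ≤ nbar) :
    numExtScalarLegs (pair1718 nbar hn) = 0 ∧ numExtVectorLegs (pair1718 nbar hn) = 1 ∧
      numTildeLegs (pair1718 nbar hn) = 0 ∧ ¬ (pair1718 nbar hn).HasVertex1315 := by
  refine ⟨by rfl, by rfl, by rfl, ?_⟩
  rintro ⟨i, hi⟩
  fin_cases i <;> simp [pair1718, pairKind, VertexKind.isOfForm1315] at hi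

/-- **p. 431** [PDF 21], verbatim: *"There are graphs with one external vector field leg."* — on the model, for every order n̄ ≥ 1:
a graph with exactly one external vector field leg (A′ or Ã) and no external scalar field leg exists (witness `tadpole18T`; also
`tadpole18A`, `pair1718`). [cite: Balaban1983Higgs3, p.431] -/
theorem exists_graph_oneExtVectorLeg (hn : 1 ≤ nbar) :
    ∃ G : Graph nbar, numExtScalarLegs G = 0 ∧ numExtVectorLegs G + numTildeLegs G = 1 ∧ ¬ G.HasVertex1315 :=
  ⟨tadpole18T nbar hn, (tadpole18T_legs hn).1, by rw [(tadpole18T_legs hn).2.1, (tadpole18T_legs hn).2.2.1],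
    (tadpole18T_legs hn).2.2.2.2⟩

/-- p. 431: such graphs occur with NONPOSITIVE degree (2.2) in d = 3, so the sentence *"do not introduce any new divergences"* has
content — witness p18's `pair1718` (one external A′-leg, D = 0, `B3Cor23ConcreteProof.pair1718_deg`).
[cite: Balaban1983Higgs3, p.431] -/
theorem exists_graph_oneExtVectorLeg_deg_nonpos (hn : 1 ≤ nbar) :
    ∃ G : Graph nbar, numExtScalarLegs G = 0 ∧ numExtVectorLegs G + numTildeLegs G = 1 ∧ G.deg 3 ≤ 0 :=
  ⟨pair1718 nbar hn, (pair1718_legs hn).1, by rw [(pair1718_legs hn).2.1, (pair1718_legs hn).2.2.1],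
    le_of_eq (pair1718_deg nbar hn).2.2⟩

/-! ## Degrees of the one-vertex witnesses (d = 3, by the budget formula (2.2)) -/

/-- kernel, d = 3: the (1.8)_{0,1}-tadpole has budget 2 (one Ã-leg), hence D = (2 − 6)/2 = −2 by `two_deg_three_eq_budget`.
[cite: Balaban1983Higgs3, (2.2) p.423] -/
theorem tadpole18T_deg (hn : 1 ≤ nbar) : (tadpole18T nbar hn).deg 3 = -2 := by
  have hb : budget (tadpole18T nbar hn) = 2 := by rfl
  have h := two_deg_three_eq_budget (tadpole18T nbar hn) (tadpole18T_legs hn).2.2.2.2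
  rw [hb] at h
  push_cast at h
  linarith

/-- kernel, d = 3: the (1.8)_{1,0}-tadpole has budget 2 (one external A′-leg), hence D = −2 by `two_deg_three_eq_budget`.
[cite: Balaban1983Higgs3, (2.2) p.423] -/
theorem tadpole18A_deg (hn : 1 ≤ nbar) : (tadpole18A nbar hn).deg 3 = -2 := by
  have hb : budget (tadpole18A nbar hn) = 2 := by rfl
  have h := two_deg_three_eq_budget (tadpole18A nbar hn) (tadpole18A_legs hn).2.2.2.2
  rw [hb] at h
  push_cast at h
  linarith

/-! ## «do not introduce any new divergences»: the internal-index weight of each witness vanishes (p. 434 mechanism) -/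

variable {n : Type*} [Fintype n] [DecidableEq n] [Nonempty n]

/-- **p. 431** *"These graphs … do not introduce any new divergences"*, in the form the model proves it (p. 434: odd loop ⇒ odd power
of q ⇒ tr = 0): the internal-index weight of the (1.8)_{0,1}-tadpole is 0 for every N ≥ 1 and every antisymmetric q — p18's
`indexWeight_eq_zero_of_one_or_three`, hypotheses discharged. [cite: Balaban1983Higgs3, p.431] -/
theorem indexWeight_tadpole18T_eq_zero (hn : 1 ≤ nbar) (q : Matrix n n ℝ) (hq : q.transpose = -q) :
    indexWeight (tadpole18T nbar hn) q = 0 :=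
  indexWeight_eq_zero_of_one_or_three _ q hq (tadpole18T_legs hn).2.2.2.2 (tadpole18T_legs hn).1
    (Or.inl (by rw [(tadpole18T_legs hn).2.1, (tadpole18T_legs hn).2.2.1]))

/-- p. 431 / p. 434: the internal-index weight of the (1.8)_{1,0}-tadpole (one uncontracted A′-leg) is 0 for every N ≥ 1 and every
antisymmetric q. [cite: Balaban1983Higgs3, p.431] -/
theorem indexWeight_tadpole18A_eq_zero (hn : 1 ≤ nbar) (q : Matrix n n ℝ) (hq : q.transpose = -q) :
    indexWeight (tadpole18A nbar hn) q = 0 :=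
  indexWeight_eq_zero_of_one_or_three _ q hq (tadpole18A_legs hn).2.2.2.2 (tadpole18A_legs hn).1
    (Or.inl (by rw [(tadpole18A_legs hn).2.1, (tadpole18A_legs hn).2.2.1]))

/-- p. 431 / p. 434: the internal-index weight of p18's degree-0 graph `pair1718` (one external A′-leg) is 0 for every N ≥ 1 and
every antisymmetric q — the divergent-by-power-counting graph with one vector leg introduces no new divergence.
[cite: Balaban1983Higgs3, p.431] -/
theorem indexWeight_pair1718_eq_zero (hn : 1 ≤ nbar) (q : Matrix n n ℝ) (hq : q.transpose = -q) :
    indexWeight (pair1718 nbar hn) q = 0 :=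
  indexWeight_eq_zero_of_one_or_three _ q hq (pair1718_legs hn).2.2.2 (pair1718_legs hn).1
    (Or.inl (by rw [(pair1718_legs hn).2.1, (pair1718_legs hn).2.2.1]))

/-- p. 431, both halves together on the model, d = 3, every n̄ ≥ 1, every N ≥ 1, every antisymmetric q: there is a graph with
exactly one external vector field leg, no external scalar leg and nonpositive degree, AND every graph of the model with exactly one
external vector field leg and no other external leg (no vertex (1.13)–(1.15)) has internal-index weight 0.
[cite: Balaban1983Higgs3, p.431] -/
theorem oneExtVectorLeg_sentence (hn : 1 ≤ nbar) (q : Matrix n n ℝ) (hq : q.transpose = -q) :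
    (∃ G : Graph nbar, numExtScalarLegs G = 0 ∧ numExtVectorLegs G + numTildeLegs G = 1 ∧ G.deg 3 ≤ 0) ∧
      ∀ G : Graph nbar, ¬ G.HasVertex1315 → numExtScalarLegs G = 0 → numExtVectorLegs G + numTildeLegs G = 1 →
        indexWeight G q = 0 :=
  ⟨exists_graph_oneExtVectorLeg_deg_nonpos hn, fun G h h0 h1 => indexWeight_eq_zero_of_one_or_three G q hq h h0 (Or.inl h1)⟩

end Literature.MathematicalPhysics.QuantumFieldTheory.Balaban1983to89.B3OneVectorLegGraphs
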